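import Summits.Ventures.PercRepro.Classify4
import Summits.Ventures.PercRepro.SMCPrinciple

/-!
# PercRepro — the `k = 4` certificate theorem (typer-2, gen 2)

`SMC4Principle_holds : SMC4Principle` — every integer `15 × 15` kernel `R` certified by
`SMC4 R := by decide` (SMC4.lean) gives `0 ≤ quadForm4 R (G.law4 p a b c d)` for every finite
multigraph, every `p ∈ [0,1]^E` and every four vertices — from p4's general single-merge concavity
theorem `smc_principle 4` (SMCPrinciple.lean, the lead's canonical proof of `SMCPrinciple k`) and the
row classification of `Classify4.lean` (`row4`, `row4_isSingleMerge_mem`,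
`row4_markedPartition_eq_iff`):

* `SMC_of_SMC4` — a certified kernel pulled back through `row4` satisfies `SMC`;
* `sum_weight_mul_row4`, `quadForm_row4_eq_quadForm4` — the quadratic form of the pulled-back kernel
  at the marked partition is `quadForm4 R` at the engine row vector `law4`.

This is the certificate pipeline for mine-1's `k = 4` rays (PLAN.md §3 D1, §9): a ray `R` becomes
a theorem by `SMC4Principle_holds R (by decide) G p hp a b c d`.
-/

namespace PercRepro

open Finset

/-- A certified `15 × 15` kernel, pulled back to partitions through `row4`, satisfies `SMC`. -/
theorem SMC_of_SMC4 (R : Matrix (Fin 15) (Fin 15) ℤ) (hR : SMC4 R) :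
    SMC (fun σ τ : Setoid (Fin 4) => (R (row4 σ) (row4 τ) : ℝ)) where
  diag_nonneg σ := by exact_mod_cast hR.1 (row4 σ)
  merge_nonpos σ τ σ' τ' h h' := by
    have key := hR.2 (row4 σ, row4 τ) (row4_isSingleMerge_mem h) (row4 σ', row4 τ')
      (row4_isSingleMerge_mem h')
    dsimp only at key
    exact_mod_cast key

namespace MultiGraph

variable {V E : Type*} (G : MultiGraph V E) [Fintype E] [DecidableEq E]

/-- A row of the engine vector as a sum over configurations. -/
theorem prob_partitionEvent_rgs4_eq_sum (p : E → ℝ) (m : Fin 4 → V) (s : Fin 15) :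
    prob p (G.partitionEvent m (rgs4 s)) =
      ∑ ω : Config E, if row4 (G.markedPartition ω m) = s then weight p ω else 0 := by
  unfold prob
  refine Finset.sum_congr rfl fun ω _ => ?_
  by_cases h : row4 (G.markedPartition ω m) = s
  · rw [if_pos h, Set.indicator_of_mem ((G.row4_markedPartition_eq_iff m s).1 h)]
  · rw [if_neg h, Set.indicator_of_notMem (fun hmem => h ((G.row4_markedPartition_eq_iff m s).2 hmem))]

/-- Summing a function of the row against the engine rows is the expectation of that function of
the row of the marked partition. -/
theorem sum_weight_mul_row4 (p : E → ℝ) (m : Fin 4 → V) (B : Fin 15 → ℝ) :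
    ∑ s, prob p (G.partitionEvent m (rgs4 s)) * B s =
      ∑ ω : Config E, weight p ω * B (row4 (G.markedPartition ω m)) := by
  simp_rw [G.prob_partitionEvent_rgs4_eq_sum p m, Finset.sum_mul]
  rw [Finset.sum_comm]
  refine Finset.sum_congr rfl fun ω _ => ?_
  rw [Finset.sum_eq_single (row4 (G.markedPartition ω m))]
  · simp
  · intro s _ hs
    simp [Ne.symm hs]
  · intro h
    exact absurd (Finset.mem_univ _) h

/-- The quadratic form of a kernel pulled back through `row4`, at the marked partition, is
`quadForm4` at the engine row vector. -/
theorem quadForm_row4_eq_quadForm4 (p : E → ℝ) (a b c d : V) (R : Matrix (Fin 15) (Fin 15) ℤ) :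
    G.quadForm p ![a, b, c, d] (fun σ τ => (R (row4 σ) (row4 τ) : ℝ)) =
      quadForm4 R (G.law4 p a b c d) := by
  unfold quadForm quadForm4 law4
  have h1 : ∀ s, ∑ t, (R s t : ℝ) * prob p (G.partitionEvent ![a, b, c, d] (rgs4 s)) *
      prob p (G.partitionEvent ![a, b, c, d] (rgs4 t)) =
      prob p (G.partitionEvent ![a, b, c, d] (rgs4 s)) *
        ∑ ω' : Config E, weight p ω' * (R s (row4 (G.markedPartition ω' ![a, b, c, d])) : ℝ) := by
    intro s
    rw [← G.sum_weight_mul_row4 p ![a, b, c, d] (fun t => (R s t : ℝ)), Finset.mul_sum]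
    exact Finset.sum_congr rfl fun t _ => by ring
  simp_rw [h1]
  rw [G.sum_weight_mul_row4 p ![a, b, c, d]
    (fun s => ∑ ω' : Config E, weight p ω' * (R s (row4 (G.markedPartition ω' ![a, b, c, d])) : ℝ))]
  refine Finset.sum_congr rfl fun ω _ => ?_
  rw [Finset.mul_sum]
  exact Finset.sum_congr rfl fun ω' _ => by ring

end MultiGraph

/-- **The SMC principle at `k = 4` in certificate form holds**: every kernel certified by
`SMC4 R := by decide` is a theorem for every finite multigraph, weights and marking
(from `smc_principle 4` and the row classification). -/
theorem SMC4Principle_holds : SMC4Principle := by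
  intro R hR V E _ _ G p hp a b c d
  have h := smc_principle 4 G p hp ![a, b, c, d] _ (SMC_of_SMC4 R hR)
  rwa [G.quadForm_row4_eq_quadForm4] at h

end PercRepro
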